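import Summits.AtomisticToContinuum.BoseEinsteinCondensation.Theorems.BECInsertionCorrectorStaticResponseBoundNearMinAffineFamily
import HarnessLib

/-!
# Near-minimiser variation for the crux `StaticResponseBound` (stmt-AtomisticToContinuum-12057), III:
# the packaged facts of the two test families `(1 + ηV_p)Φ`, `(1 + σV_p²)Φ`

Helper file (part 2b) for the registered stub `stub_nearMinCosSqMoment` of line `uv-thomson-force-wave` (skeleton v4,
seat c1), sequel of `…NearMinAffineFamily.lean`.  Pointwise facts on the density wave `V_p = densityWave L k`
(`|V_p| ≤ N`, Bose symmetry, `|∇V_p|² = |p|²∑sin² ≤ |p|²N`), and the registered helper `nearMin_variation_facts`: for a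
finite-energy periodic state `Φ` at fixed `(N, L, k)` where the crux's discriminant family holds with constant `B > 0`,
eight real numbers — the moments `u₁…u₄` of `V_p…V_p⁴` in `|Φ|²`, the second-order coefficients `e₁, e₂` of the
`(1+ηV_p)` family, `f₂` of the `(1+σV_p²)` family and the mode stiffness `G = ∫|∇V_p|²|Φ|²` — with all a-priori bounds,
the variational principle along both families, the discriminant along the first, and the identity that the linear
coefficient of the second family is `e₂ − G` (`∇φ·∇(V²φ) = |∇(Vφ)|² − |∇V|²φ²`).
References: [ReedSimonIV1978] §XIII.2.
-/

noncomputable section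

namespace Summit.AtomisticToContinuum.BoseEinsteinCondensation.Cruxes.StaticResponseBound.UvThomsonForceWave

open MeasureTheory Filter
open scoped ENNReal NNReal BigOperators Topology
open Literature.MathematicalPhysics.QuantumManyBody.BoseGas
open Summit.AtomisticToContinuum.BoseEinsteinCondensation.Theorems.StaticResponseBound.Negative
open Summit.AtomisticToContinuum.BoseEinsteinCondensation.Theorems.StaticResponseToHMinusOne
  (ae_weight_mul_ofReal_eq integrableOn_toReal_weight_mul_norm_sq)

variable {N : ℕ} {L : ℝ}

/-! ### The density wave `V_p` -/

section Mode

open Summit.AtomisticToContinuum.BoseEinsteinCondensation.Theorems.StaticResponseBound.Negative.UvThomsonFlow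
  (pderiv_densityWave contDiff_densityWave isLatticePeriodic_densityWave sum_coeff_sq)

/-- `|V_p(X)| ≤ N` (a sum of `N` cosines). [folklore] -/
theorem abs_densityWave_le (L : ℝ) (k : Fin 3 → ℤ) (X : Config N) :
    |UvThomsonFlow.densityWave L k X| ≤ N := by
  unfold UvThomsonFlow.densityWave
  calc |∑ j : Fin N, Real.cos (arg L k (X j))| ≤ ∑ j : Fin N, |Real.cos (arg L k (X j))| :=
        Finset.abs_sum_le_sum_abs _ _
    _ ≤ ∑ _j : Fin N, (1 : ℝ) := Finset.sum_le_sum fun j _ => Real.abs_cos_le_one _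
    _ = N := by simp

/-- `V_p` is Bose symmetric. [folklore] -/
theorem densityWave_comp_perm (L : ℝ) (k : Fin 3 → ℤ) (σ : Equiv.Perm (Fin N)) (X : Config N) :
    UvThomsonFlow.densityWave L k (X ∘ σ) = UvThomsonFlow.densityWave L k X := by
  unfold UvThomsonFlow.densityWave
  exact Equiv.sum_comp σ (fun j => Real.cos (arg L k (X j)))

/-- `|∇V_p|² = |p|² ∑ᵢ sin² θ_k(xᵢ)`. [folklore] -/
theorem gradDot_densityWave_self (L : ℝ) (k : Fin 3 → ℤ) (X : Config N) :
    gradDot (UvThomsonFlow.densityWave L k) (UvThomsonFlow.densityWave L k) X =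
      psq L k * ∑ i : Fin N, Real.sin (arg L k (X i)) ^ 2 := by
  unfold gradDot
  rw [Finset.mul_sum]
  refine Finset.sum_congr rfl fun i _ => ?_
  simp_rw [pderiv_densityWave]
  have h : ∀ m : Fin 3, -Real.sin (arg L k (X i)) * (2 * Real.pi / L * k m) *
      (-Real.sin (arg L k (X i)) * (2 * Real.pi / L * k m)) =
      Real.sin (arg L k (X i)) ^ 2 * (2 * Real.pi / L * k m) ^ 2 := fun m => by ring
  simp_rw [h, ← Finset.mul_sum, sum_coeff_sq]
  ring

/-- `|∇V_p|² ≤ |p|² N` pointwise. [folklore] -/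
theorem gradDot_densityWave_self_le (L : ℝ) (k : Fin 3 → ℤ) (X : Config N) :
    gradDot (UvThomsonFlow.densityWave L k) (UvThomsonFlow.densityWave L k) X ≤ psq L k * N := by
  rw [gradDot_densityWave_self]
  refine mul_le_mul_of_nonneg_left ?_ (psq_nonneg L k)
  calc ∑ i : Fin N, Real.sin (arg L k (X i)) ^ 2 ≤ ∑ _i : Fin N, (1 : ℝ) :=
        Finset.sum_le_sum fun i _ => by
          rw [sq_le_one_iff_abs_le_one]; exact Real.abs_sin_le_one _
    _ = N := by simp


end Mode


/-! ### Coefficient bounds and the packaged facts for the extraction -/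

section Package

open Summit.AtomisticToContinuum.BoseEinsteinCondensation.Theorems.StaticResponseBound.Negative.UvThomsonFlow
  (contDiff_densityWave isLatticePeriodic_densityWave)
open Summit.AtomisticToContinuum.BoseEinsteinCondensation.Theorems.StaticResponseToHMinusOne (exists_measurable_weight)

/-- Moments of a bounded continuous density against the Born weight: `|∫ g|Φ|²| ≤ M` if `|g| ≤ M`. [folklore] -/
theorem abs_integral_mul_norm_sq_le (Φ : PeriodicTrialState N L) {g : Config N → ℝ} (hg : Continuous g) {M : ℝ}
    (hM : ∀ X, |g X| ≤ M) : |∫ X in cellN N L, g X * ‖Φ.ψ X‖ ^ 2| ≤ M := by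
  have hρc : Continuous fun X => ‖Φ.ψ X‖ ^ 2 := (Φ.contDiff.continuous.norm).pow 2
  have iρ : IntegrableOn (fun X => ‖Φ.ψ X‖ ^ 2) (cellN N L) := integrableOn_cellN hρc L
  have ig : IntegrableOn (fun X => g X * ‖Φ.ψ X‖ ^ 2) (cellN N L) := integrableOn_cellN (hg.mul hρc) L
  have h1 : ∫ X in cellN N L, g X * ‖Φ.ψ X‖ ^ 2 ≤ ∫ X in cellN N L, M * ‖Φ.ψ X‖ ^ 2 :=
    integral_mono ig (iρ.const_mul M) fun X =>
      mul_le_mul_of_nonneg_right ((le_abs_self _).trans (hM X)) (sq_nonneg _)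
  have h2 : ∫ X in cellN N L, (-M) * ‖Φ.ψ X‖ ^ 2 ≤ ∫ X in cellN N L, g X * ‖Φ.ψ X‖ ^ 2 :=
    integral_mono (iρ.const_mul (-M)) ig fun X =>
      mul_le_mul_of_nonneg_right (by linarith [neg_abs_le (g X), hM X]) (sq_nonneg _)
  rw [integral_const_mul, integral_norm_sq_eq_one Φ, mul_one] at h1 h2
  exact abs_le.2 ⟨h2, h1⟩

/-- Nonnegative moments: `0 ≤ ∫ g|Φ|²` if `0 ≤ g`. [folklore] -/
theorem integral_mul_norm_sq_nonneg (Φ : PeriodicTrialState N L) {g : Config N → ℝ} (hg : ∀ X, 0 ≤ g X) :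
    0 ≤ ∫ X in cellN N L, g X * ‖Φ.ψ X‖ ^ 2 :=
  integral_nonneg fun X => mul_nonneg (hg X) (sq_nonneg _)

/-- **The packaged near-minimiser facts.**  For a finite-energy periodic state `Φ` at fixed `(N, L, k)` where the
crux's discriminant family holds with constant `B > 0`, there are real numbers — the moments `u₁, u₂, u₃, u₄` of
`V_p, V_p², V_p³, V_p⁴` in `|Φ|²`, the second-order coefficients `e₁, e₂` of the `(1+ηV_p)` family, `f₂` of the
`(1+σV_p²)` family and the mode stiffness `G = ∫|∇V_p|²|Φ|²` — such that `u₂ = ∫(∑ⱼcos θⱼ)²|Φ|²` is the quantity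
of the stub, all the a-priori bounds hold, the variational principle holds along both families and the
discriminant inequality holds along the first; the linear coefficient of the second family is `e₂ − G`
(the identity `∇φ·∇(V²φ) = |∇(Vφ)|² − |∇V|²φ²`). [folklore] -/
theorem nearMin_variation_facts' (hL : 0 < L) {v : ℝ → ℝ≥0∞} (Φ : PeriodicTrialState N L)
    (hfin : periodicEnergy v Φ ≠ ⊤) (k : Fin 3 → ℤ) {B : ℝ} (hB : 0 < B)
    (hdisc : ∀ (t : ℝ) (Ψ : PeriodicTrialState N L), periodicEnergy v Ψ ≠ ⊤ →
      (periodicGroundStateEnergy v N L).toReal - B * t ^ 2 ≤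
        (periodicEnergy v Ψ).toReal + t * cosMean L k Ψ) :
    ∃ u₁ u₂ u₃ u₄ e₁ e₂ f₂ G : ℝ,
      u₂ = ∫ X in cellN N L, (∑ j, Real.cos (2 * Real.pi / L * ∑ i, (k i : ℝ) * X j i)) ^ 2 * ‖Φ.ψ X‖ ^ 2 ∧
      |u₁| ≤ N ∧ 0 ≤ u₂ ∧ u₂ ≤ (N : ℝ) ^ 2 ∧ |u₃| ≤ (N : ℝ) ^ 3 ∧ 0 ≤ u₄ ∧ u₄ ≤ (N : ℝ) ^ 4 ∧
      0 ≤ G ∧ G ≤ psq L k * N ∧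
      0 ≤ e₂ ∧ e₂ ≤ 3 * (N : ℝ) ^ 2 * (periodicEnergy v Φ).toReal + 2 * N * psq L k ∧
      0 ≤ f₂ ∧ f₂ ≤ 3 * (N : ℝ) ^ 4 * (periodicEnergy v Φ).toReal + 8 * (N : ℝ) ^ 3 * psq L k ∧
      (∀ η : ℝ, |η| * N ≤ 1 / 4 →
        (periodicGroundStateEnergy v N L).toReal * (1 + 2 * η * u₁ + η ^ 2 * u₂) ≤
            (periodicEnergy v Φ).toReal + 2 * η * e₁ + η ^ 2 * e₂ ∧
          (u₁ + 2 * η * u₂ + η ^ 2 * u₃) ^ 2 ≤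
            4 * B * (1 + 2 * η * u₁ + η ^ 2 * u₂) *
              (((periodicEnergy v Φ).toReal + 2 * η * e₁ + η ^ 2 * e₂) -
                (periodicGroundStateEnergy v N L).toReal * (1 + 2 * η * u₁ + η ^ 2 * u₂))) ∧
      (∀ σ : ℝ, |σ| * (N : ℝ) ^ 2 ≤ 1 / 4 →
        (periodicGroundStateEnergy v N L).toReal * (1 + 2 * σ * u₂ + σ ^ 2 * u₄) ≤
          (periodicEnergy v Φ).toReal + 2 * σ * (e₂ - G) + σ ^ 2 * f₂) := by
  obtain ⟨W, hW, -, -, hEW⟩ := exists_measurable_weight v N L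
  have hfin' : (∫⁻ X in cellN N L, kineticDensity Φ.ψ X + W X * ((‖Φ.ψ X‖₊ : ℝ≥0∞)) ^ 2) ≠ ⊤ := by
    rw [← hEW Φ]; exact hfin
  -- opaque names for the mode and the two real components (no unfolding during arithmetic)
  obtain ⟨V, hVeq⟩ : ∃ V : Config N → ℝ, V = UvThomsonFlow.densityWave L k := ⟨_, rfl⟩
  obtain ⟨φ₁, hφ₁eq⟩ : ∃ φ : Config N → ℝ, φ = fun Y => (Φ.ψ Y).re := ⟨_, rfl⟩
  obtain ⟨φ₂, hφ₂eq⟩ : ∃ φ : Config N → ℝ, φ = fun Y => (Φ.ψ Y).im := ⟨_, rfl⟩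
  have hVc : ContDiff ℝ 1 V := by rw [hVeq]; exact contDiff_densityWave L k
  have hVd : Differentiable ℝ V := hVc.differentiable one_ne_zero
  have hV2c : ContDiff ℝ 1 fun Y => V Y ^ 2 := hVc.pow 2
  have hVbd : ∀ X, |V X| ≤ N := by rw [hVeq]; exact abs_densityWave_le L k
  have hVbd' : ∀ (m : ℕ) X, |V X ^ m| ≤ (N : ℝ) ^ m := fun m X => by
    rw [abs_pow]; exact pow_le_pow_left₀ (abs_nonneg _) (hVbd X) m
  have hVper : IsLatticePeriodic L V := by rw [hVeq]; exact isLatticePeriodic_densityWave hL.ne' k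
  have hVsymm : ∀ (σ : Equiv.Perm (Fin N)) (X : Config N), V (X ∘ σ) = V X := by
    rw [hVeq]; exact densityWave_comp_perm L k
  have hgV : ∀ X, gradDot V V X ≤ psq L k * N := by rw [hVeq]; exact gradDot_densityWave_self_le L k
  have hφ₁ : ContDiff ℝ 1 φ₁ := by rw [hφ₁eq]; exact Complex.reCLM.contDiff.comp Φ.contDiff
  have hφ₂ : ContDiff ℝ 1 φ₂ := by rw [hφ₂eq]; exact Complex.imCLM.contDiff.comp Φ.contDiff
  have hφ₁d : Differentiable ℝ φ₁ := hφ₁.differentiable one_ne_zero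
  have hφ₂d : Differentiable ℝ φ₂ := hφ₂.differentiable one_ne_zero
  have hρc : Continuous fun X => ‖Φ.ψ X‖ ^ 2 := (Φ.contDiff.continuous.norm).pow 2
  have hρeq : ∀ X, φ₁ X ^ 2 + φ₂ X ^ 2 = ‖Φ.ψ X‖ ^ 2 := fun X => by
    rw [hφ₁eq, hφ₂eq, Complex.sq_norm, Complex.normSq_apply]; ring
  -- opaque names for the integrals
  obtain ⟨u₁, hu₁⟩ : ∃ x : ℝ, x = ∫ X in cellN N L, V X * ‖Φ.ψ X‖ ^ 2 := ⟨_, rfl⟩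
  obtain ⟨u₂, hu₂⟩ : ∃ x : ℝ, x = ∫ X in cellN N L, V X ^ 2 * ‖Φ.ψ X‖ ^ 2 := ⟨_, rfl⟩
  obtain ⟨u₃, hu₃⟩ : ∃ x : ℝ, x = ∫ X in cellN N L, V X ^ 3 * ‖Φ.ψ X‖ ^ 2 := ⟨_, rfl⟩
  obtain ⟨u₄, hu₄⟩ : ∃ x : ℝ, x = ∫ X in cellN N L, V X ^ 4 * ‖Φ.ψ X‖ ^ 2 := ⟨_, rfl⟩
  obtain ⟨K₀, hK₀⟩ : ∃ x : ℝ, x = ∫ X in cellN N L, (gradDot φ₁ φ₁ X + gradDot φ₂ φ₂ X) := ⟨_, rfl⟩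
  obtain ⟨K₁, hK₁⟩ : ∃ x : ℝ, x = ∫ X in cellN N L, (gradDot φ₁ (fun Y => V Y * φ₁ Y) X +
    gradDot φ₂ (fun Y => V Y * φ₂ Y) X) := ⟨_, rfl⟩
  obtain ⟨K₂, hK₂⟩ : ∃ x : ℝ, x = ∫ X in cellN N L, (gradDot (fun Y => V Y * φ₁ Y) (fun Y => V Y * φ₁ Y) X +
    gradDot (fun Y => V Y * φ₂ Y) (fun Y => V Y * φ₂ Y) X) := ⟨_, rfl⟩
  obtain ⟨K₃, hK₃⟩ : ∃ x : ℝ, x = ∫ X in cellN N L, (gradDot φ₁ (fun Y => V Y ^ 2 * φ₁ Y) X +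
    gradDot φ₂ (fun Y => V Y ^ 2 * φ₂ Y) X) := ⟨_, rfl⟩
  obtain ⟨K₄, hK₄⟩ : ∃ x : ℝ, x = ∫ X in cellN N L, (gradDot (fun Y => V Y ^ 2 * φ₁ Y) (fun Y => V Y ^ 2 * φ₁ Y) X +
    gradDot (fun Y => V Y ^ 2 * φ₂ Y) (fun Y => V Y ^ 2 * φ₂ Y) X) := ⟨_, rfl⟩
  obtain ⟨P₀, hP₀⟩ : ∃ x : ℝ, x = ∫ X in cellN N L, (W X).toReal * ‖Φ.ψ X‖ ^ 2 := ⟨_, rfl⟩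
  obtain ⟨P₁, hP₁⟩ : ∃ x : ℝ, x = ∫ X in cellN N L, (W X).toReal * (V X * ‖Φ.ψ X‖ ^ 2) := ⟨_, rfl⟩
  obtain ⟨P₂, hP₂⟩ : ∃ x : ℝ, x = ∫ X in cellN N L, (W X).toReal * (V X ^ 2 * ‖Φ.ψ X‖ ^ 2) := ⟨_, rfl⟩
  obtain ⟨P₄, hP₄⟩ : ∃ x : ℝ, x = ∫ X in cellN N L, (W X).toReal * ((V X ^ 2) ^ 2 * ‖Φ.ψ X‖ ^ 2) := ⟨_, rfl⟩
  obtain ⟨G, hG⟩ : ∃ x : ℝ, x = ∫ X in cellN N L, gradDot V V X * ‖Φ.ψ X‖ ^ 2 := ⟨_, rfl⟩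
  obtain ⟨EΦ, hEΦdef⟩ : ∃ x : ℝ, x = (periodicEnergy v Φ).toReal := ⟨_, rfl⟩
  obtain ⟨E₀r, hE₀rdef⟩ : ∃ x : ℝ, x = (periodicGroundStateEnergy v N L).toReal := ⟨_, rfl⟩
  -- ### the energy of `Φ`: `EΦ = K₀ + P₀`
  have hEΦ : EΦ = K₀ + P₀ := by
    rw [hEΦdef, toReal_energy_eq hW hEW Φ hfin, hK₀, hP₀]
    congr 1
    unfold cellKineticEnergy
    rw [hφ₁eq, hφ₂eq]
    refine integral_congr_ae (ae_of_all _ fun X => ?_)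
    exact kineticDensityReal_eq_gradDot_re_add_im ((Φ.contDiff.differentiable one_ne_zero) X)
  have hK₀nn : 0 ≤ K₀ := by
    rw [hK₀]; exact integral_nonneg fun X => add_nonneg (gradDot_self_nonneg _ X) (gradDot_self_nonneg _ X)
  have hP₀nn : 0 ≤ P₀ := by
    rw [hP₀]; exact integral_nonneg fun X => mul_nonneg ENNReal.toReal_nonneg (sq_nonneg _)
  have hK₀le : K₀ ≤ EΦ := by linarith
  have hP₀le : P₀ ≤ EΦ := by linarith
  -- ### integrability facts
  have iP₀ : IntegrableOn (fun X => (W X).toReal * ‖Φ.ψ X‖ ^ 2) (cellN N L) :=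
    integrableOn_toReal_weight_mul_norm_sq (Θ := Φ) hW hfin'
  have hVφ : ∀ {φ : Config N → ℝ}, ContDiff ℝ 1 φ → ContDiff ℝ 1 fun Y => V Y * φ Y := fun hφ => hVc.mul hφ
  have hV2φ : ∀ {φ : Config N → ℝ}, ContDiff ℝ 1 φ → ContDiff ℝ 1 fun Y => V Y ^ 2 * φ Y := fun hφ => hV2c.mul hφ
  have iK : IntegrableOn (fun X => gradDot φ₁ φ₁ X + gradDot φ₂ φ₂ X) (cellN N L) :=
    integrableOn_cellN ((continuous_gradDot hφ₁ hφ₁).add (continuous_gradDot hφ₂ hφ₂)) L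
  have iGρ : IntegrableOn (fun X => gradDot V V X * ‖Φ.ψ X‖ ^ 2) (cellN N L) :=
    integrableOn_cellN ((continuous_gradDot hVc hVc).mul hρc) L
  -- ### bounds on the moments
  have hu₁b : |u₁| ≤ N := by rw [hu₁]; exact abs_integral_mul_norm_sq_le Φ hVc.continuous hVbd
  have hu₂nn : 0 ≤ u₂ := by rw [hu₂]; exact integral_mul_norm_sq_nonneg Φ fun X => sq_nonneg _
  have hu₂b : u₂ ≤ (N : ℝ) ^ 2 := by
    rw [hu₂]; exact (le_abs_self _).trans (abs_integral_mul_norm_sq_le Φ (hVc.continuous.pow 2) (hVbd' 2))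
  have hu₃b : |u₃| ≤ (N : ℝ) ^ 3 := by rw [hu₃]; exact abs_integral_mul_norm_sq_le Φ (hVc.continuous.pow 3) (hVbd' 3)
  have hu₄nn : 0 ≤ u₄ := by rw [hu₄]; exact integral_mul_norm_sq_nonneg Φ fun X => by positivity
  have hu₄b : u₄ ≤ (N : ℝ) ^ 4 := by
    rw [hu₄]; exact (le_abs_self _).trans (abs_integral_mul_norm_sq_le Φ (hVc.continuous.pow 4) (hVbd' 4))
  -- ### the mode stiffness `G`
  have hGnn : 0 ≤ G := by rw [hG]; exact integral_mul_norm_sq_nonneg Φ fun X => gradDot_self_nonneg _ X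
  have hGb : G ≤ psq L k * N := by
    have h := abs_integral_mul_norm_sq_le Φ (continuous_gradDot hVc hVc) (M := psq L k * N) fun X => by
      rw [abs_of_nonneg (gradDot_self_nonneg _ X)]; exact hgV X
    rw [hG]; exact (le_abs_self _).trans h
  -- ### potential coefficients
  have hK₂nn : 0 ≤ K₂ := by
    rw [hK₂]; exact integral_nonneg fun X => add_nonneg (gradDot_self_nonneg _ X) (gradDot_self_nonneg _ X)
  have hK₄nn : 0 ≤ K₄ := by
    rw [hK₄]; exact integral_nonneg fun X => add_nonneg (gradDot_self_nonneg _ X) (gradDot_self_nonneg _ X)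
  have hP₂nn : 0 ≤ P₂ := by
    rw [hP₂]; exact integral_nonneg fun X => mul_nonneg ENNReal.toReal_nonneg (by positivity)
  have hP₄nn : 0 ≤ P₄ := by
    rw [hP₄]; exact integral_nonneg fun X => mul_nonneg ENNReal.toReal_nonneg (by positivity)
  have hP₂b : P₂ ≤ (N : ℝ) ^ 2 * P₀ := by
    have i2 : IntegrableOn (fun X => (W X).toReal * (V X ^ 2 * ‖Φ.ψ X‖ ^ 2)) (cellN N L) :=
      integrableOn_weight_mul_bdd hW hfin' (hVc.continuous.pow 2) (hVbd' 2)
    have iR : IntegrableOn (fun X => (N : ℝ) ^ 2 * ((W X).toReal * ‖Φ.ψ X‖ ^ 2)) (cellN N L) := iP₀.const_mul _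
    have hptw : ∀ X, (W X).toReal * (V X ^ 2 * ‖Φ.ψ X‖ ^ 2) ≤ (N : ℝ) ^ 2 * ((W X).toReal * ‖Φ.ψ X‖ ^ 2) := by
      intro X
      have h1 : V X ^ 2 ≤ (N : ℝ) ^ 2 := (le_abs_self _).trans (hVbd' 2 X)
      have h2 : 0 ≤ (W X).toReal * ‖Φ.ψ X‖ ^ 2 := mul_nonneg ENNReal.toReal_nonneg (sq_nonneg _)
      calc (W X).toReal * (V X ^ 2 * ‖Φ.ψ X‖ ^ 2) = V X ^ 2 * ((W X).toReal * ‖Φ.ψ X‖ ^ 2) := by ring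
        _ ≤ (N : ℝ) ^ 2 * ((W X).toReal * ‖Φ.ψ X‖ ^ 2) := mul_le_mul_of_nonneg_right h1 h2
    have h := integral_mono i2 iR hptw
    rw [integral_const_mul] at h
    rw [hP₂, hP₀]; exact h
  have hV4eq : ∀ X, (V X ^ 2) ^ 2 = V X ^ 4 := fun X => by ring
  have hP₄b : P₄ ≤ (N : ℝ) ^ 4 * P₀ := by
    have hb4 : ∀ X, |(V X ^ 2) ^ 2| ≤ (N : ℝ) ^ 4 := fun X => by rw [hV4eq X]; exact hVbd' 4 X
    have i4 : IntegrableOn (fun X => (W X).toReal * ((V X ^ 2) ^ 2 * ‖Φ.ψ X‖ ^ 2)) (cellN N L) :=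
      integrableOn_weight_mul_bdd hW hfin' ((hVc.continuous.pow 2).pow 2) hb4
    have iR : IntegrableOn (fun X => (N : ℝ) ^ 4 * ((W X).toReal * ‖Φ.ψ X‖ ^ 2)) (cellN N L) := iP₀.const_mul _
    have hptw : ∀ X, (W X).toReal * ((V X ^ 2) ^ 2 * ‖Φ.ψ X‖ ^ 2) ≤
        (N : ℝ) ^ 4 * ((W X).toReal * ‖Φ.ψ X‖ ^ 2) := by
      intro X
      have h1 : (V X ^ 2) ^ 2 ≤ (N : ℝ) ^ 4 := (le_abs_self _).trans (hb4 X)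
      have h2 : 0 ≤ (W X).toReal * ‖Φ.ψ X‖ ^ 2 := mul_nonneg ENNReal.toReal_nonneg (sq_nonneg _)
      calc (W X).toReal * ((V X ^ 2) ^ 2 * ‖Φ.ψ X‖ ^ 2) = (V X ^ 2) ^ 2 * ((W X).toReal * ‖Φ.ψ X‖ ^ 2) := by ring
        _ ≤ (N : ℝ) ^ 4 * ((W X).toReal * ‖Φ.ψ X‖ ^ 2) := mul_le_mul_of_nonneg_right h1 h2
    have h := integral_mono i4 iR hptw
    rw [integral_const_mul] at h
    rw [hP₄, hP₀]; exact h
  -- ### kinetic coefficients through `|∇(Uφ)|² ≤ 2U²|∇φ|² + 2φ²|∇U|²`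
  have hK₂b : K₂ ≤ 2 * (N : ℝ) ^ 2 * K₀ + 2 * G := by
    have iL : IntegrableOn (fun X => gradDot (fun Y => V Y * φ₁ Y) (fun Y => V Y * φ₁ Y) X +
        gradDot (fun Y => V Y * φ₂ Y) (fun Y => V Y * φ₂ Y) X) (cellN N L) :=
      integrableOn_cellN ((continuous_gradDot (hVφ hφ₁) (hVφ hφ₁)).add (continuous_gradDot (hVφ hφ₂) (hVφ hφ₂))) L
    have iR : IntegrableOn (fun X => 2 * (N : ℝ) ^ 2 * (gradDot φ₁ φ₁ X + gradDot φ₂ φ₂ X) +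
        2 * (gradDot V V X * ‖Φ.ψ X‖ ^ 2)) (cellN N L) := (iK.const_mul _).add (iGρ.const_mul _)
    have hptw : ∀ X, gradDot (fun Y => V Y * φ₁ Y) (fun Y => V Y * φ₁ Y) X +
        gradDot (fun Y => V Y * φ₂ Y) (fun Y => V Y * φ₂ Y) X ≤
        2 * (N : ℝ) ^ 2 * (gradDot φ₁ φ₁ X + gradDot φ₂ φ₂ X) + 2 * (gradDot V V X * ‖Φ.ψ X‖ ^ 2) := by
      intro X
      have h1 := gradDot_mul_self_le (hVd X) (hφ₁d X)
      have h2 := gradDot_mul_self_le (hVd X) (hφ₂d X)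
      have hV2 : V X ^ 2 ≤ (N : ℝ) ^ 2 := (le_abs_self _).trans (hVbd' 2 X)
      have hg1 := gradDot_self_nonneg φ₁ X
      have hg2 := gradDot_self_nonneg φ₂ X
      have hm := mul_le_mul_of_nonneg_right hV2 (add_nonneg hg1 hg2)
      rw [← hρeq X]
      linarith [h1, h2, hm]
    have h := integral_mono iL iR hptw
    rw [integral_add (iK.const_mul _) (iGρ.const_mul _), integral_const_mul, integral_const_mul] at h
    rw [hK₂, hK₀, hG]; exact h
  have hK₄b : K₄ ≤ 2 * (N : ℝ) ^ 4 * K₀ + 8 * (N : ℝ) ^ 2 * G := by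
    have iL : IntegrableOn (fun X => gradDot (fun Y => V Y ^ 2 * φ₁ Y) (fun Y => V Y ^ 2 * φ₁ Y) X +
        gradDot (fun Y => V Y ^ 2 * φ₂ Y) (fun Y => V Y ^ 2 * φ₂ Y) X) (cellN N L) :=
      integrableOn_cellN ((continuous_gradDot (hV2φ hφ₁) (hV2φ hφ₁)).add
        (continuous_gradDot (hV2φ hφ₂) (hV2φ hφ₂))) L
    have hV2d : Differentiable ℝ fun Y => V Y ^ 2 := hV2c.differentiable one_ne_zero
    have iR : IntegrableOn (fun X => 2 * (N : ℝ) ^ 4 * (gradDot φ₁ φ₁ X + gradDot φ₂ φ₂ X) +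
        8 * (N : ℝ) ^ 2 * (gradDot V V X * ‖Φ.ψ X‖ ^ 2)) (cellN N L) := (iK.const_mul _).add (iGρ.const_mul _)
    have hptw : ∀ X, gradDot (fun Y => V Y ^ 2 * φ₁ Y) (fun Y => V Y ^ 2 * φ₁ Y) X +
        gradDot (fun Y => V Y ^ 2 * φ₂ Y) (fun Y => V Y ^ 2 * φ₂ Y) X ≤
        2 * (N : ℝ) ^ 4 * (gradDot φ₁ φ₁ X + gradDot φ₂ φ₂ X) + 8 * (N : ℝ) ^ 2 * (gradDot V V X * ‖Φ.ψ X‖ ^ 2) := by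
      intro X
      have h1 := gradDot_mul_self_le (V := fun Y => V Y ^ 2) (hV2d X) (hφ₁d X)
      have h2 := gradDot_mul_self_le (V := fun Y => V Y ^ 2) (hV2d X) (hφ₂d X)
      have hsq := gradDot_sq_self (hVd X)
      rw [hsq] at h1 h2
      have hV2 : V X ^ 2 ≤ (N : ℝ) ^ 2 := (le_abs_self _).trans (hVbd' 2 X)
      have hV4 : (V X ^ 2) ^ 2 ≤ (N : ℝ) ^ 4 := by
        calc (V X ^ 2) ^ 2 ≤ ((N : ℝ) ^ 2) ^ 2 := pow_le_pow_left₀ (sq_nonneg (V X)) hV2 2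
          _ = (N : ℝ) ^ 4 := by ring
      have hg1 := gradDot_self_nonneg φ₁ X
      have hg2 := gradDot_self_nonneg φ₂ X
      have hgVn := gradDot_self_nonneg V X
      have hm1 := mul_le_mul_of_nonneg_right hV4 (add_nonneg hg1 hg2)
      have hm2 := mul_le_mul_of_nonneg_right hV2
        (mul_nonneg hgVn (add_nonneg (sq_nonneg (φ₁ X)) (sq_nonneg (φ₂ X))))
      rw [← hρeq X]
      linarith [h1, h2, hm1, hm2]
    have h := integral_mono iL iR hptw
    rw [integral_add (iK.const_mul _) (iGρ.const_mul _), integral_const_mul, integral_const_mul] at h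
    rw [hK₄, hK₀, hG]; exact h
  -- ### the identity `K₃ = K₂ − G` (the second family against the first)
  have hkey : K₃ = K₂ - G := by
    have iL : IntegrableOn (fun X => gradDot (fun Y => V Y * φ₁ Y) (fun Y => V Y * φ₁ Y) X +
        gradDot (fun Y => V Y * φ₂ Y) (fun Y => V Y * φ₂ Y) X) (cellN N L) :=
      integrableOn_cellN ((continuous_gradDot (hVφ hφ₁) (hVφ hφ₁)).add (continuous_gradDot (hVφ hφ₂) (hVφ hφ₂))) L
    rw [hK₃, hK₂, hG, ← integral_sub iL iGρ]
    refine integral_congr_ae (ae_of_all _ fun X => ?_)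
    dsimp only
    rw [gradDot_sq_modulation (hVd X) (hφ₁d X), gradDot_sq_modulation (hVd X) (hφ₂d X), ← hρeq X]
    ring
  -- ### the two families
  refine ⟨u₁, u₂, u₃, u₄, K₁ + P₁, K₂ + P₂, K₄ + P₄, G, ?_, hu₁b, hu₂nn, hu₂b, hu₃b, hu₄nn, hu₄b, hGnn, hGb,
    add_nonneg hK₂nn hP₂nn, ?_, add_nonneg hK₄nn hP₄nn, ?_, ?_, ?_⟩
  · rw [hu₂, hVeq]
    refine integral_congr_ae (ae_of_all _ fun X => ?_)
    simp only [UvThomsonFlow.densityWave, arg]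
  · rw [← hEΦdef]
    have hN2 : (0 : ℝ) ≤ (N : ℝ) ^ 2 := by positivity
    have t1 := mul_le_mul_of_nonneg_left hK₀le (by positivity : (0:ℝ) ≤ 2 * (N : ℝ) ^ 2)
    have t2 := mul_le_mul_of_nonneg_left hP₀le hN2
    linarith [hK₂b, hP₂b, t1, t2]
  · rw [← hEΦdef]
    have hN4 : (0 : ℝ) ≤ (N : ℝ) ^ 4 := by positivity
    have t1 := mul_le_mul_of_nonneg_left hK₀le (by positivity : (0:ℝ) ≤ 2 * (N : ℝ) ^ 4)
    have t2 := mul_le_mul_of_nonneg_left hP₀le hN4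
    have t3 := mul_le_mul_of_nonneg_left hGb (by positivity : (0:ℝ) ≤ 8 * (N : ℝ) ^ 2)
    have e3 : 8 * (N : ℝ) ^ 2 * (psq L k * N) = 8 * (N : ℝ) ^ 3 * psq L k := by ring
    linarith [hK₄b, hP₄b, t1, t2, t3, e3]
  · intro η hη
    have hb₁' : u₂ = ∫ X in cellN N L, V X * V X * ‖Φ.ψ X‖ ^ 2 := by
      rw [hu₂]
      refine integral_congr_ae (ae_of_all _ fun X => ?_)
      simp only; ring
    have hb₂' : u₃ = ∫ X in cellN N L, V X * V X ^ 2 * ‖Φ.ψ X‖ ^ 2 := by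
      rw [hu₃]
      refine integral_congr_ae (ae_of_all _ fun X => ?_)
      simp only; ring
    exact affineFamily' hW hEW Φ hfin k hB hdisc hVc hVper hVsymm hVbd hη hVeq hφ₁eq hφ₂eq
      hu₁ hu₂ hu₁ hb₁' hb₂' (e₁ := K₁ + P₁) (e₂ := K₂ + P₂) (by rw [hK₁, hP₁]) (by rw [hK₂, hP₂])
  · intro σ hσ
    have hU2per : IsLatticePeriodic L fun Y => V Y ^ 2 := hVper.comp fun x => x ^ 2
    have hU2symm : ∀ (τ : Equiv.Perm (Fin N)) (X : Config N), V (X ∘ τ) ^ 2 = V X ^ 2 :=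
      fun τ X => by rw [hVsymm]
    obtain ⟨c₁, hc₁⟩ : ∃ x : ℝ, x = ∫ X in cellN N L, V X * V X ^ 2 * ‖Φ.ψ X‖ ^ 2 := ⟨_, rfl⟩
    obtain ⟨c₂, hc₂⟩ : ∃ x : ℝ, x = ∫ X in cellN N L, V X * (V X ^ 2) ^ 2 * ‖Φ.ψ X‖ ^ 2 := ⟨_, rfl⟩
    have hu₄' : u₄ = ∫ X in cellN N L, (V X ^ 2) ^ 2 * ‖Φ.ψ X‖ ^ 2 := by
      rw [hu₄]
      refine integral_congr_ae (ae_of_all _ fun X => ?_)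
      simp only; ring
    have h := (affineFamily' hW hEW Φ hfin k hB hdisc hV2c hU2per hU2symm (hVbd' 2) hσ hVeq hφ₁eq hφ₂eq
      hu₂ hu₄' hu₁ hc₁ hc₂ (e₁ := K₃ + P₂) (e₂ := K₄ + P₄) (by rw [hK₃, hP₂]) (by rw [hK₄, hP₄])).1
    rw [hkey] at h
    linarith [h]

/-- **The packaged near-minimiser facts** (registered helper form `nearMin_variation_facts`, sub-goal of the stub
`stub_nearMinCosSqMoment`): verbatim `nearMin_variation_facts'` with all binders explicit. [folklore] -/
theorem nearMin_variation_facts : ∀ {N : ℕ} {L : ℝ}, 0 < L → ∀ {v : ℝ → ℝ≥0∞} (Φ : PeriodicTrialState N L),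
    periodicEnergy v Φ ≠ ⊤ → ∀ (k : Fin 3 → ℤ) {B : ℝ}, 0 < B →
    (∀ (t : ℝ) (Ψ : PeriodicTrialState N L), periodicEnergy v Ψ ≠ ⊤ →
      (periodicGroundStateEnergy v N L).toReal - B * t ^ 2 ≤
        (periodicEnergy v Ψ).toReal + t * cosMean L k Ψ) →
    ∃ u₁ u₂ u₃ u₄ e₁ e₂ f₂ G : ℝ,
      u₂ = ∫ X in cellN N L, (∑ j, Real.cos (2 * Real.pi / L * ∑ i, (k i : ℝ) * X j i)) ^ 2 * ‖Φ.ψ X‖ ^ 2 ∧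
      |u₁| ≤ N ∧ 0 ≤ u₂ ∧ u₂ ≤ (N : ℝ) ^ 2 ∧ |u₃| ≤ (N : ℝ) ^ 3 ∧ 0 ≤ u₄ ∧ u₄ ≤ (N : ℝ) ^ 4 ∧
      0 ≤ G ∧ G ≤ psq L k * N ∧
      0 ≤ e₂ ∧ e₂ ≤ 3 * (N : ℝ) ^ 2 * (periodicEnergy v Φ).toReal + 2 * N * psq L k ∧
      0 ≤ f₂ ∧ f₂ ≤ 3 * (N : ℝ) ^ 4 * (periodicEnergy v Φ).toReal + 8 * (N : ℝ) ^ 3 * psq L k ∧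
      (∀ η : ℝ, |η| * N ≤ 1 / 4 →
        (periodicGroundStateEnergy v N L).toReal * (1 + 2 * η * u₁ + η ^ 2 * u₂) ≤
            (periodicEnergy v Φ).toReal + 2 * η * e₁ + η ^ 2 * e₂ ∧
          (u₁ + 2 * η * u₂ + η ^ 2 * u₃) ^ 2 ≤
            4 * B * (1 + 2 * η * u₁ + η ^ 2 * u₂) *
              (((periodicEnergy v Φ).toReal + 2 * η * e₁ + η ^ 2 * e₂) -
                (periodicGroundStateEnergy v N L).toReal * (1 + 2 * η * u₁ + η ^ 2 * u₂))) ∧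
      (∀ σ : ℝ, |σ| * (N : ℝ) ^ 2 ≤ 1 / 4 →
        (periodicGroundStateEnergy v N L).toReal * (1 + 2 * σ * u₂ + σ ^ 2 * u₄) ≤
          (periodicEnergy v Φ).toReal + 2 * σ * (e₂ - G) + σ ^ 2 * f₂) :=
  fun hL _ Φ hfin k _ hB hdisc => nearMin_variation_facts' hL Φ hfin k hB hdisc

end Package
end Summit.AtomisticToContinuum.BoseEinsteinCondensation.Cruxes.StaticResponseBound.UvThomsonForceWave

end
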